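import Summits.QuantumFields.BalabanUV.Beta.CompositeVertexKernelLiftKernel
import Summits.QuantumFields.BalabanUV.Beta.CompositeVertexKernelBounds

/-!
# `BalabanUV.Beta.LamCoeffPullbackDecay` — binder row D1 ∕ (C1) OWNER an2 (gen 60), PART 9: **THE ONE LETTER THE ROAD CANNOT SUPPLY — THE PULLED-BACK
# COEFFICIENTS DECAY** (road FP d1-p3 g36 LANDED-3 ∕ CLOSE l.67030: «`LocStencil (SLam N (cf j) (symHessFFAt ρ_c Lc)) (Cs j) δ` for the literal's `cf` — your
# `locStencil_SLam` from `cf`'s decay … for the pulled-back `lamCoeffOf`»): a top coefficient family decaying like `C·e^{−δ·|N•y − u|₁}` from the top slots, pulled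
# back through F3's depth-`n` composite linear kernel with bounded bricks (F6a″'s `λ′ ↦ Σ'_y λ′ · compLinKer (ℓ∘(·+k+1)) L n (κ,z) (·,y)`), decays like
# `C′·e^{−δ·|N′•z − u|₁}` from the lower slots at the finer blocking `N′` with `N = N′·L^n` — a B7-type transport of the decay letter through the finite windows,
# constant `C′ = (d+1)·(wid L n + 2)^{d+1}·((d+1)(2L)^{d+1}Bℓ)^n·e^{δ(d+1)·N′·wid L n}·C` (uniform in `u`, `z`), i.e. EXACTLY `InterLevelTransport.locStencil_SLam`'s `hc` shape

[folklore] finite-window bookkeeping over F3 (`compLinKer`, `winF ∕ wid`, `compLinKer_eq_zero`, `abs_compLinKer_le`) and F6a″ (`mem_piFinset_of_mem_winF`); 0 `def`,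
0 `def … : Prop`, 0 sorry, nothing cited; no table VALUE.  NOT (C1), NOT D1, NEVER «G-an2-4 closed», NOT BetaPertH, NOT continuum, NOT Clay.
HONEST FRAMING (cell charter, verbatim): «discharging `BetaPertH` makes Bałaban's UV stability UNCONDITIONAL — a real constructive-QFT result; it is NOT
the continuum limit and NOT the Clay problem.»  HONEST DEPENDENCY (verbatim): «continuum YM on T⁴ ⇐ BetaPertH ∧ nine spine estimates (0/9 proved); BetaPertH ⇐
(D1) ∧ (D4) ∧ CAP+tail; G-an2-4 gates asym, D1 and NE2/3/4.»  ABSOLUTE RULE (cell, verbatim): «No internally-minted statement may enter as a cited fact. Every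
hypothesis is either kernel-proved in this package or a verbatim quotation of a PUBLISHED theorem with page reference.»
Unit `b2b-balaban-beta-an2` gen 60 (row-D1 owner), 2026-08-25; `bears_on: R4-O/T1|T1a` (a (C1)-side letter; moves no node counter).  No existing file touched.
-/

noncomputable section

namespace Summit.QuantumFields.BalabanUV.Beta.LamCoeffPullbackDecay

open Finset
open scoped BigOperators
open Literature.MathematicalPhysics.QuantumFieldTheory.Balaban1983to89
open Literature.MathematicalPhysics.QuantumFieldTheory.Balaban1983to89.Beta
open B12Sec2to5 (l1 l1_nonneg)
open ExpKernelCalculus (l1_sub_triangle l1_sub_symm)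
open AffineAveraging (Site)
open AveragingHessianKernels (Bond)
open Summit.QuantumFields.BalabanUV.Beta.CompositeVertexKernelRec (compLinKer winF wid mem_winF_iff compLinKer_eq_zero abs_compLinKer_le)
open Summit.QuantumFields.BalabanUV.Beta.CompositeVertexKernelLiftKernel (mem_piFinset_of_mem_winF)

variable {d : ℕ} {ℓ : ℕ → Fin (d + 1) → Site (d + 1) → Bond (d + 1) → ℝ} {L : ℕ}

/-! ## §1 Geometry of the upper window -/

/-- [folklore] The explicit finite box containing the upper window of a lower site `z` has at most `(W + 2)^{d+1}` points (`0 < N`). -/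
theorem card_upper_box_le {N W : ℕ} (hN : 0 < N) (z : Site (d + 1)) :
    ((Fintype.piFinset fun i => Finset.Icc ((z i - (W : ℤ)) / (N : ℤ)) (z i / (N : ℤ))).card : ℝ) ≤ ((W : ℝ) + 2) ^ (d + 1) := by
  rw [Fintype.card_piFinset]
  have hN' : (0 : ℤ) < (N : ℤ) := by exact_mod_cast hN
  have hN1 : (1 : ℤ) ≤ (N : ℤ) := by exact_mod_cast hN
  have hi : ∀ i : Fin (d + 1), ((Finset.Icc ((z i - (W : ℤ)) / (N : ℤ)) (z i / (N : ℤ))).card : ℝ) ≤ (W : ℝ) + 2 := by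
    intro i
    rw [Int.card_Icc]
    set a : ℤ := (z i - (W : ℤ)) / (N : ℤ) with ha
    set b : ℤ := z i / (N : ℤ) with hb
    have hbz : b * (N : ℤ) ≤ z i := Int.ediv_mul_le _ (ne_of_gt hN')
    have haz : z i - (W : ℤ) < (a + 1) * (N : ℤ) := Int.lt_ediv_add_one_mul_self _ hN'
    have hle : b + 1 - a ≤ ((W + 2 : ℕ) : ℤ) := by
      by_contra h8
      rw [not_le] at h8
      push_cast at h8
      have h9 : ((W : ℤ) + 2) * (N : ℤ) ≤ (b - a) * (N : ℤ) := mul_le_mul_of_nonneg_right (by linarith) hN'.le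
      nlinarith
    have h0 : ((b + 1 - a).toNat : ℝ) ≤ (((W + 2 : ℕ) : ℕ) : ℝ) := by exact_mod_cast Int.toNat_le.mpr hle
    push_cast at h0
    exact h0
  calc ((∏ i : Fin (d + 1), (Finset.Icc ((z i - (W : ℤ)) / (N : ℤ)) (z i / (N : ℤ))).card : ℕ) : ℝ)
      = ∏ i : Fin (d + 1), ((Finset.Icc ((z i - (W : ℤ)) / (N : ℤ)) (z i / (N : ℤ))).card : ℝ) := by push_cast; rfl
    _ ≤ ∏ _i : Fin (d + 1), ((W : ℝ) + 2) := Finset.prod_le_prod (fun i _ => by positivity) fun i _ => hi i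
    _ = ((W : ℝ) + 2) ^ (d + 1) := by rw [Finset.prod_const, Finset.card_univ, Fintype.card_fin]

/-- [folklore] Inside the window the two block positions are close: `z ∈ winF (L^n) W y`, `N = N′·L^n` ⟹ `|N•y − N′•z|₁ ≤ (d+1)·N′·W`. -/
theorem l1_top_sub_lower_le {N N' n W : ℕ} (hN : N = N' * L ^ n) {y z : Site (d + 1)} (h : z ∈ winF (L ^ n) W y) :
    l1 ((N : ℤ) • y - (N' : ℤ) • z) ≤ ((d : ℝ) + 1) * ((N' : ℝ) * W) := by
  unfold l1
  have hi : ∀ i : Fin (d + 1), |((((N : ℤ) • y - (N' : ℤ) • z) i : ℤ) : ℝ)| ≤ (N' : ℝ) * W := by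
    intro i
    obtain ⟨h1, h2⟩ := (mem_winF_iff.1 h) i
    have e : ((N : ℤ) • y - (N' : ℤ) • z) i = (N' : ℤ) * ((L : ℤ) ^ n * y i - z i) := by
      simp only [Pi.sub_apply, Pi.smul_apply, smul_eq_mul, hN, Nat.cast_mul, Nat.cast_pow]; ring
    rw [e]
    push_cast
    rw [abs_mul, abs_of_nonneg (by positivity : (0 : ℝ) ≤ (N' : ℝ))]
    refine mul_le_mul_of_nonneg_left ?_ (by positivity)
    rw [abs_le]
    have h1' : ((L : ℝ) ^ n) * (y i : ℝ) ≤ (z i : ℝ) := by exact_mod_cast (by simpa [Nat.cast_pow] using h1)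
    have h2' : (z i : ℝ) ≤ ((L : ℝ) ^ n) * (y i : ℝ) + (W : ℝ) := by exact_mod_cast (by simpa [Nat.cast_pow] using h2)
    constructor <;> linarith
  calc ∑ i : Fin (d + 1), |((((N : ℤ) • y - (N' : ℤ) • z) i : ℤ) : ℝ)| ≤ ∑ _i : Fin (d + 1), (N' : ℝ) * W := Finset.sum_le_sum fun i _ => hi i
    _ = ((d : ℝ) + 1) * ((N' : ℝ) * W) := by rw [Finset.sum_const, Finset.card_univ, Fintype.card_fin, nsmul_eq_mul]; push_cast; ring

/-- [folklore] Hence the decay weight transfers from the top block position to the lower one at the price `e^{δ(d+1)N′W}`: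
`e^{−δ|N•y − u|₁} ≤ e^{δ(d+1)N′W} · e^{−δ|N′•z − u|₁}` (`0 ≤ δ`). -/
theorem exp_top_le_exp_lower {N N' n W : ℕ} (hN : N = N' * L ^ n) {δ : ℝ} (hδ : 0 ≤ δ) {y z : Site (d + 1)} (h : z ∈ winF (L ^ n) W y)
    (u : Site (d + 1)) :
    Real.exp (-δ * l1 ((N : ℤ) • y - u)) ≤ Real.exp (δ * (((d : ℝ) + 1) * ((N' : ℝ) * W))) * Real.exp (-δ * l1 ((N' : ℤ) • z - u)) := by
  rw [← Real.exp_add]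
  refine Real.exp_le_exp.2 ?_
  have htri : l1 ((N' : ℤ) • z - u) ≤ l1 ((N' : ℤ) • z - (N : ℤ) • y) + l1 ((N : ℤ) • y - u) := l1_sub_triangle _ _ _
  have hw : l1 ((N' : ℤ) • z - (N : ℤ) • y) ≤ ((d : ℝ) + 1) * ((N' : ℝ) * W) := by
    rw [l1_sub_symm]; exact l1_top_sub_lower_le (L := L) hN h
  nlinarith

/-! ## §2 The pulled-back coefficients decay -/

/-- [folklore] **THE PULLED-BACK DECAY LETTER** (`locStencil_SLam`'s `hc` shape at the finer blocking): if the top coefficients decay like `C·e^{−δ|N•y − u|₁}`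
(uniformly in the slot direction `μ`), the bricks are bounded by `Bℓ`, `0 < L`, `0 ≤ δ`, and `N = N′·L^n`, then the coefficients pulled back through the depth-`n`
composite linear kernel of the shifted family decay from the LOWER slots like
`(d+1)·(wid L n + 2)^{d+1}·((d+1)(2L)^{d+1}Bℓ)^n·C·e^{δ(d+1)N′·wid L n} · e^{−δ|N′•z − u|₁}`. -/
theorem abs_pullback_le {Bℓ C δ : ℝ} (hB : 0 ≤ Bℓ) (hℓb : ∀ i μ y g, |ℓ i μ y g| ≤ Bℓ) (hL : 0 < L) (hC : 0 ≤ C) (hδ : 0 ≤ δ)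
    {N N' : ℕ} (k n : ℕ) (hN : N = N' * L ^ n) (u : Site (d + 1)) {c : Fin (d + 1) → Site (d + 1) → ℝ}
    (hc : ∀ μ y, |c μ y| ≤ C * Real.exp (-δ * l1 ((N : ℤ) • y - u))) (κ : Fin (d + 1)) (z : Site (d + 1)) :
    |∑ μ : Fin (d + 1), ∑' y, c μ y * compLinKer (fun i => ℓ (k + 1 + i)) L n (κ, z) (μ, y)|
      ≤ (((d : ℝ) + 1) * (((wid L n : ℝ) + 2) ^ (d + 1)) * ((((d : ℝ) + 1) * (2 * (L : ℝ)) ^ (d + 1) * Bℓ) ^ n)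
          * Real.exp (δ * (((d : ℝ) + 1) * ((N' : ℝ) * (wid L n)))) * C) * Real.exp (-δ * l1 ((N' : ℤ) • z - u)) := by
  set Cn : ℝ := (((d : ℝ) + 1) * (2 * (L : ℝ)) ^ (d + 1) * Bℓ) ^ n with hCn
  set E : ℝ := Real.exp (δ * (((d : ℝ) + 1) * ((N' : ℝ) * (wid L n)))) with hE
  set T : ℝ := Real.exp (-δ * l1 ((N' : ℤ) • z - u)) with hT
  set U : Finset (Site (d + 1)) := Fintype.piFinset fun i => Finset.Icc ((z i - (wid L n : ℤ)) / ((L ^ n : ℕ) : ℤ)) (z i / ((L ^ n : ℕ) : ℤ)) with hU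
  have hCn0 : 0 ≤ Cn := pow_nonneg (by positivity) n
  have hLn : 0 < L ^ n := pow_pos hL n
  -- each slice is a finite sum over the upper box `U`, and each term is bounded by `C·E·T·Cn`
  have hslice : ∀ μ : Fin (d + 1), |∑' y, c μ y * compLinKer (fun i => ℓ (k + 1 + i)) L n (κ, z) (μ, y)| ≤ (U.card : ℝ) * (C * E * T * Cn) := by
    intro μ
    rw [tsum_eq_sum (s := U) (fun y hy => by
      rw [compLinKer_eq_zero (ℓ := fun i => ℓ (k + 1 + i)) n (f := (κ, z)) (g := (μ, y))
        (fun h => hy (by simpa [hU, Nat.cast_pow] using mem_piFinset_of_mem_winF hLn h)), mul_zero])]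
    calc |∑ y ∈ U, c μ y * compLinKer (fun i => ℓ (k + 1 + i)) L n (κ, z) (μ, y)|
        ≤ ∑ y ∈ U, C * E * T * Cn := by
          refine (Finset.abs_sum_le_sum_abs _ _).trans (Finset.sum_le_sum fun y _ => ?_)
          rw [abs_mul]
          by_cases hw : z ∈ winF (L ^ n) (wid L n) y
          · calc |c μ y| * |compLinKer (fun i => ℓ (k + 1 + i)) L n (κ, z) (μ, y)|
                ≤ (C * Real.exp (-δ * l1 ((N : ℤ) • y - u))) * Cn :=
                  mul_le_mul (hc μ y) (abs_compLinKer_le (ℓ := fun i => ℓ (k + 1 + i)) (L := L) hB (fun m μ' y' g => hℓb _ μ' y' g) n _ _)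
                    (abs_nonneg _) (by positivity)
              _ ≤ (C * (E * T)) * Cn := by
                  refine mul_le_mul_of_nonneg_right (mul_le_mul_of_nonneg_left ?_ hC) hCn0
                  exact exp_top_le_exp_lower (L := L) hN hδ hw u
              _ = C * E * T * Cn := by ring
          · rw [compLinKer_eq_zero (ℓ := fun i => ℓ (k + 1 + i)) n (f := (κ, z)) (g := (μ, y)) hw, abs_zero, mul_zero]
            positivity
      _ = (U.card : ℝ) * (C * E * T * Cn) := by rw [Finset.sum_const, nsmul_eq_mul]
  have hUcard : (U.card : ℝ) ≤ ((wid L n : ℝ) + 2) ^ (d + 1) := by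
    have h := card_upper_box_le (d := d) (W := wid L n) hLn z
    simpa [hU, Nat.cast_pow] using h
  calc |∑ μ : Fin (d + 1), ∑' y, c μ y * compLinKer (fun i => ℓ (k + 1 + i)) L n (κ, z) (μ, y)|
      ≤ ∑ μ : Fin (d + 1), (U.card : ℝ) * (C * E * T * Cn) := (Finset.abs_sum_le_sum_abs _ _).trans (Finset.sum_le_sum fun μ _ => hslice μ)
    _ = ((d : ℝ) + 1) * ((U.card : ℝ) * (C * E * T * Cn)) := by
        rw [Finset.sum_const, Finset.card_univ, Fintype.card_fin, nsmul_eq_mul]; push_cast; ring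
    _ ≤ ((d : ℝ) + 1) * ((((wid L n : ℝ) + 2) ^ (d + 1)) * (C * E * T * Cn)) := by
        refine mul_le_mul_of_nonneg_left (mul_le_mul_of_nonneg_right hUcard ?_) (by positivity)
        have : 0 ≤ T := (Real.exp_pos _).le
        have : 0 ≤ E := (Real.exp_pos _).le
        positivity
    _ = (((d : ℝ) + 1) * (((wid L n : ℝ) + 2) ^ (d + 1)) * Cn * E * C) * T := by ring

end Summit.QuantumFields.BalabanUV.Beta.LamCoeffPullbackDecay

end
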